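import Summits.BirchSwinnertonDyer.BirchSwinnertonDyer.Theorems.GenusKolyvaginAtTwoEquivariantKolyvaginExactAtTwoSelmerDescentSplit
import Literature.NumberTheory.EllipticCurves.PeriodIndexSupportProofs
import HarnessLib

/-!
# Route `GenusKolyvaginAtTwo`, LINE 6, KEY crux Q3 (inner statement of stmt-BirchSwinnertonDyer-22137):
# a class of `H¹(F, E)` dying over an extension of `F_v` UNRAMIFIED in the Galois sense dies over `F_v` (good
# reduction); the local inertia group fixes `√c` for `c ≡ 1 (mod 4)` — the local inputs of Lemma 4.3 over `ℚ` at `2`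

Helper (seat `bsd-line-gk2-p3` g13; `--supports` the crux, closes nothing). The transfers of this lineage
`…SelmerDescentUnramified/Quadratic/Ramified` read McCallum's Lemma 4.3 over `ℚ` from the `K`-statement through
UNRAMIFIED classes of `H¹(·, E[n])`, hence need `v ∤ n`; for the pair descent at `2` (`n = 2^M`) this leaves
the place `v = 2` when it does not split in `K` (`d_K ≡ 5 mod 8`). This file supplies the two local inputs of a
transfer that works one level down, in `H¹(F_v, E)` itself, at any level (sequel: `…SelmerDescentInert`):

* §1 `mem_localRestrictionKer_of_tower_of_inertia_le_finGalSubgroup` — for `E = W/F` with GOOD reduction at `v`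
  and a finite extension `E'/F_v` whose Galois closure is fixed by the local inertia group `I_𝔐 ≤ Γ_{F_v}`
  (`I_𝔐 ≤ Γ_{\tilde E'}`, the tree's `finGalSubgroup`): **a class of `H¹(F, E)` dying over `E'` dies over `F_v`.**
  The kernel of `H¹(F_v, E) → H¹(E', E)` is inflated from `Γ_{\tilde E'}` (`resKer_le_range_inflClass`), so it
  consists of classes of cocycles vanishing on `I_𝔐` — UNRAMIFIED classes, which vanish at good reduction: Milne,
  ADT I Prop. 3.8, the tree's theorem `Milne2006_unramifiedClass_eq_zero_holds` (Lang + Hensel).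
* §2 `smul_eq_of_mem_localInertia_of_sq_eq_one_add_four_mul` — **`I_𝔐` fixes `√c` for a `v`-unit
  `c = 1 + 4d ∈ 𝓞_v`, at any `v` incl. `v ∣ 2`** (`(1 + √c)/2` is a root of `X² − X − d`; local analogue of the
  tree's `smul_eq_of_mem_inertia_of_sq_eq_of_notMem`, which needs `v ∤ 2`).
* §3 `adjoin_algebraMap_adicCompletion_eq_top` (`L_w = F_v[θ]` for `L = F[θ]`: closed finite-dimensional
  subspace + density) and `localInertia_le_finGalSubgroup_of_sq_eq_one_add_four_mul` — **`I_𝔐 ≤ Γ_{\tilde L_w}` for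
  `L = F(√c)`, `c ≡ 1 (mod 4)`, `v ∤ c`**: every `F_v`-conjugate of `L_w` is generated by a square root of `c`
  ("`v` is unramified in `F(√c)`", in the Galois form consumed by §1).

THEOREMS ONLY (no definition, no named fact, no `sorry`, standard axioms). BSD is not proved by any of this.

References: [MilneADT2006] I Prop. 3.8; [SerreGaloisCohomology1997] I §2.4, §5.8; [NeukirchANT1999] Ch. II
(7.13), (8.3), (9.6), Ch. V Lemma (3.4) (`K(√c)`, `c ≡ 1 mod 4`, is unramified at `2`); [SerreLocalFields1979]
Ch. IV §2; [McCallumLMS1991] §4 Lemma 4.3.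
-/

set_option autoImplicit false
set_option linter.dupNamespace false -- tree convention: `Summit.BirchSwinnertonDyer.BirchSwinnertonDyer.Theorems` (summit = sub-problem)

noncomputable section

open scoped Classical

universe u

namespace Summit.BirchSwinnertonDyer.BirchSwinnertonDyer.Theorems.GenusExact.SelmerDescent

open WeierstrassCurve NumberField IsDedekindDomain Field
open Literature.NumberTheory.EllipticCurves Literature.NumberTheory.GaloisRepresentations

/-! ## §1 A class dying over `E' ⊇ F_v` with `I_𝔐 ≤ Γ_{Ẽ'}` dies over `F_v` (good reduction) -/

section LocalTransfer

variable {F : Type u} [Field F] [NumberField F] (W : WeierstrassCurve F) [W.IsElliptic]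
variable (v : HeightOneSpectrum (𝓞 F))
variable (E' : Type u) [Field E'] [Algebra F E'] [Algebra (v.adicCompletion F) E']
  [IsScalarTower F (v.adicCompletion F) E'] [FiniteDimensional (v.adicCompletion F) E']

/-- **A class of `H¹(F, E)` dying over a finite extension `E'` of `F_v` whose Galois closure is fixed by the
local inertia group dies over `F_v`, at a place of good reduction.** The restriction to `E'` factors as
`H¹(F, E) → H¹(F_v, E) → H¹(E', E)`; the kernel of the second map is inflated from `Γ_{Ẽ'}`
(`resKer_le_range_inflClass`), so the middle class is represented by a cocycle vanishing on `Γ_{Ẽ'} ⊇ I_𝔐`,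
i.e. by an UNRAMIFIED cocycle, whose class vanishes at good reduction (Milne, ADT I Prop. 3.8 — the tree's
`Milne2006_unramifiedClass_eq_zero_holds`: Lang's theorem and Hensel's lemma). [cite: MilneADT2006, I Prop. 3.8]
[cite: SerreGaloisCohomology1997, I §5.8] -/
theorem mem_localRestrictionKer_of_tower_of_inertia_le_finGalSubgroup (hgood : W.HasGoodReductionAt v)
    {𝔐 : Ideal (v.localAbsIntegers)} (h𝔐 : 𝔐 ∈ v.localPrimesAbove)
    (hI : 𝔐.inertia (absoluteGaloisGroup (v.adicCompletion F)) ≤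
      finGalSubgroup (E := v.adicCompletion F) E')
    {c : W.galH1} (hc : c ∈ W.localRestrictionKer E') :
    c ∈ W.localRestrictionKer (v.adicCompletion F) := by
  let ι₁ : AlgebraicClosure F →ₐ[F] AlgebraicClosure (v.adicCompletion F) :=
    closureEmb (K := F) (v.adicCompletion F)
  let ι₂ : AlgebraicClosure (v.adicCompletion F) →ₐ[v.adicCompletion F] AlgebraicClosure E' :=
    closureEmb (K := v.adicCompletion F) E'
  rw [← WeierstrassCurve.localRestrictionKerOfEmb_eq_holds W E' ((ι₂.restrictScalars F).comp ι₁)] at hc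
  change c ∈ resKer (resGalOfEmb ((ι₂.restrictScalars F).comp ι₁))
    (pointsMapOfEmb W ((ι₂.restrictScalars F).comp ι₁)) (pointsMapOfEmb_smul W _) at hc
  rw [resKer_eq_ker, AddMonoidHom.mem_ker,
    resH1Hom_congr (resGalOfEmb_comp_tower ι₁ ι₂) (pointsMapOfEmb_comp_tower W ι₁ ι₂) _
      (fun x m ↦ by
        simp only [ContinuousMonoidHom.comp_toFun, AddMonoidHom.coe_comp, Function.comp_apply,
          pointsMapOfEmb_smul, pointsMapTower_smul]),
    ← resH1Hom_comp (resGalOfEmb ι₁) (pointsMapOfEmb W ι₁) (pointsMapOfEmb_smul W ι₁)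
      (resGalOfEmb (K := v.adicCompletion F) ι₂) _ (pointsMapTower_smul W ι₂), AddMonoidHom.comp_apply,
    ← AddMonoidHom.mem_ker, ← resKer_eq_ker] at hc
  -- the middle class is inflated from `Γ_{Ẽ'}`: represented by a cocycle vanishing on `Γ_{Ẽ'} ⊇ I_𝔐`
  obtain ⟨f, hf⟩ := resKer_le_range_inflClass (resGalOfEmb (K := v.adicCompletion F) ι₂)
    (pointsMapTower W ι₂) (pointsMapTower_smul W ι₂) (pointsMapTower_bijective W ι₂)
    (finGalSubgroup (E := v.adicCompletion F) E') (isOpen_finGalSubgroup E')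
    (finGalSubgroup_le_range_resGal E') hc
  have hzero := Milne2006_unramifiedClass_eq_zero_holds W v hgood h𝔐
    (toContOneCocycle (localPoints W (v.adicCompletion F)) (finGalSubgroup (E := v.adicCompletion F) E')
      (isOpen_finGalSubgroup E') f)
    (fun σ hσ ↦ cocyclesVanishingOn.apply_of_mem f (hI hσ))
  rw [← inflClass_apply, hf] at hzero
  exact hzero

end LocalTransfer

/-! ## §2 Local inertia fixes the square roots of `v`-units `c ≡ 1 (mod 4)` -/

section LocalInertia

variable {F : Type u} [Field F] [NumberField F] (v : HeightOneSpectrum (𝓞 F))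

/-- **The inertia group of `K̄_v/K_v` fixes `√c` for a `v`-unit `c ≡ 1 (mod 4𝓞_v)`**, at ANY finite place `v`
(also `v ∣ 2`): for `𝔐` a prime of the local absolute integers `\bar 𝓞_v` above `𝓂_v`, `σ ∈ I_𝔐 ≤ Γ_{F_v}`,
`c = 1 + 4d ∈ 𝓞_v ∖ 𝓂_v` and `α ∈ K̄_v` with `α² = c`: `σ • α = α`. Proof: `β = (1 + α)/2` is a root of
`X² − X − d`, so `β ∈ \bar 𝓞_v` and `σβ − β ∈ 𝔐`; `σα = ±α`, and `σα = −α` gives `σβ − β = 1 − 2β = −α ∈ 𝔐`,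
whence `c = α² ∈ 𝔐 ∩ 𝓞_v = 𝓂_v`, a contradiction. (`F_v(√c)/F_v` is unramified: for `v ∤ 2` this is the
unit criterion, for `v ∣ 2` the congruence `c ≡ 1 mod 4`.) [cite: NeukirchANT1999, Ch. II Prop. (7.13) and
Ch. V Lemma (3.4)] [cite: SerreLocalFields1979, Ch. IV §2] -/
theorem smul_eq_of_mem_localInertia_of_sq_eq_one_add_four_mul {𝔐 : Ideal (v.localAbsIntegers)}
    (h𝔐 : 𝔐 ∈ v.localPrimesAbove) {σ : absoluteGaloisGroup (v.adicCompletion F)}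
    (hσ : σ ∈ 𝔐.inertia (absoluteGaloisGroup (v.adicCompletion F)))
    {c d : v.adicCompletionIntegers F} (hcd : c = 1 + 4 * d)
    (hc : c ∉ IsLocalRing.maximalIdeal (v.adicCompletionIntegers F))
    {α : AlgebraicClosure (v.adicCompletion F)}
    (hα : α ^ 2 = algebraMap (v.adicCompletionIntegers F) (AlgebraicClosure (v.adicCompletion F)) c) :
    σ • α = α := by
  haveI : 𝔐.IsPrime := h𝔐.1
  haveI : 𝔐.LiesOver (IsLocalRing.maximalIdeal (v.adicCompletionIntegers F)) := h𝔐.2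
  haveI : CharZero (v.adicCompletion F) :=
    charZero_of_injective_algebraMap (algebraMap F (v.adicCompletion F)).injective
  haveI : CharZero (AlgebraicClosure (v.adicCompletion F)) :=
    charZero_of_injective_algebraMap (algebraMap (v.adicCompletion F) _).injective
  have h2 : (2 : AlgebraicClosure (v.adicCompletion F)) ≠ 0 := two_ne_zero
  have h4 : (4 : AlgebraicClosure (v.adicCompletion F)) ≠ 0 := by
    rw [show (4 : AlgebraicClosure (v.adicCompletion F)) = 2 * 2 by norm_num]; exact mul_ne_zero h2 h2
  -- the algebraic integer `β = (1 + α)/2`, a root of `X² - X - d`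
  obtain ⟨β, h2β⟩ : ∃ β : AlgebraicClosure (v.adicCompletion F), 2 * β = 1 + α :=
    ⟨(1 + α) / 2, mul_div_cancel₀ _ h2⟩
  have hαβ : α = 2 * β - 1 := by linear_combination -h2β
  have hαd : α ^ 2 = 1 + 4 * algebraMap (v.adicCompletionIntegers F) (AlgebraicClosure (v.adicCompletion F)) d := by
    rw [hα, hcd, map_add, map_one, map_mul, map_ofNat]
  have hβroot : β ^ 2 - β - algebraMap (v.adicCompletionIntegers F) (AlgebraicClosure (v.adicCompletion F)) d = 0 := by
    have h : (4 : AlgebraicClosure (v.adicCompletion F)) *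
        (β ^ 2 - β - algebraMap (v.adicCompletionIntegers F) (AlgebraicClosure (v.adicCompletion F)) d) = 0 := by
      rw [hαβ] at hαd
      linear_combination hαd
    exact (mul_eq_zero.mp h).resolve_left h4
  have hβint : β ∈ v.localAbsIntegers := by
    change β ∈ absIntegers (v.adicCompletionIntegers F) (v.adicCompletion F)
    rw [absIntegers, mem_integralClosure_iff]
    refine ⟨Polynomial.X ^ 2 - (Polynomial.X + Polynomial.C d), ?_, ?_⟩
    · refine (Polynomial.monic_X_pow 2).sub_of_left ?_
      rw [Polynomial.degree_X_pow, Polynomial.degree_X_add_C]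
      exact_mod_cast one_lt_two
    · rw [← hβroot]
      simp only [Polynomial.eval₂_sub, Polynomial.eval₂_add, Polynomial.eval₂_X_pow, Polynomial.eval₂_X,
        Polynomial.eval₂_C]
      ring
  set z : v.localAbsIntegers := ⟨β, hβint⟩ with hzdef
  -- `σ • z - z ∈ 𝔐`
  have h1 : σ • z - z ∈ 𝔐 := by
    have hσ' := hσ
    rw [Ideal.inertia, AddSubgroup.mem_inertia] at hσ'
    exact hσ' z
  have hcoe : ((σ • z : v.localAbsIntegers) : AlgebraicClosure (v.adicCompletion F)) = σ • β := by
    simp [hzdef, integralClosure.coe_smul]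
  -- `σ` fixes `F_v`, so `σ α = ± α`
  have hσc : σ • (algebraMap (v.adicCompletionIntegers F) (AlgebraicClosure (v.adicCompletion F)) c) =
      algebraMap (v.adicCompletionIntegers F) (AlgebraicClosure (v.adicCompletion F)) c := by
    rw [IsScalarTower.algebraMap_apply (v.adicCompletionIntegers F) (v.adicCompletion F)
      (AlgebraicClosure (v.adicCompletion F)), absoluteGaloisGroup.smul_def, AlgEquiv.commutes]
  have hσ2 : σ • (2 : AlgebraicClosure (v.adicCompletion F)) = 2 := by
    rw [absoluteGaloisGroup.smul_def]; exact map_ofNat _ 2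
  have hsq : (σ • α) ^ 2 = α ^ 2 := by rw [← smul_pow', hα, hσc]
  rcases sq_eq_sq_iff_eq_or_eq_neg.mp hsq with h | h
  · exact h
  · exfalso
    -- then `σ β = 1 - β`, `1 - 2 z ∈ 𝔐`, and `(1 - 2 z)² = c ∈ 𝔐 ∩ 𝓞_v = 𝓂_v`
    have hσβ : σ • β = 1 - β := by
      have h' : 2 * (σ • β) = 2 * (1 - β) := by
        have h'' : σ • (2 * β) = 1 + σ • α := by rw [h2β, smul_add, smul_one]
        rw [smul_mul', hσ2, h] at h''
        linear_combination h'' + h2β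
      exact mul_left_cancel₀ h2 h'
    have hz : σ • z - z = 1 - (z + z) := Subtype.ext (by
      rw [Subalgebra.coe_sub, hcoe, hσβ, Subalgebra.coe_sub, Subalgebra.coe_one, Subalgebra.coe_add]
      simp only [hzdef]
      ring)
    have h3 : (1 - (z + z)) ^ 2 = algebraMap (v.adicCompletionIntegers F) v.localAbsIntegers c :=
      Subtype.ext (by
        rw [Subalgebra.coe_pow, Subalgebra.coe_sub, Subalgebra.coe_one, Subalgebra.coe_add,
          Subalgebra.coe_algebraMap, ← hα, hαβ]
        simp only [hzdef]
        ring)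
    have h5 : algebraMap (v.adicCompletionIntegers F) v.localAbsIntegers c ∈ 𝔐 := by
      rw [← h3, sq, ← hz]
      exact 𝔐.mul_mem_left _ h1
    apply hc
    rw [show IsLocalRing.maximalIdeal (v.adicCompletionIntegers F) =
        𝔐.comap (algebraMap (v.adicCompletionIntegers F) v.localAbsIntegers) from Ideal.LiesOver.over,
      Ideal.mem_comap]
    exact h5

end LocalInertia

/-! ## §3 `L = F(θ)`, `θ² = c ≡ 1 (mod 4)`, `v ∤ c`: the local inertia group fixes `\tilde L_w` -/

section Quadratic

open scoped Valued

variable {F : Type u} [Field F] [NumberField F]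
variable (L : Type u) [Field L] [NumberField L] [Algebra F L]
variable (v : HeightOneSpectrum (𝓞 F)) (w : HeightOneSpectrum (𝓞 L)) [w.asIdeal.LiesOver v.asIdeal]

/-- **`L_w = F_v[θ]` for `L = F[θ]`**: the completion of `L = F[θ]` at `w ∣ v` is generated over `F_v` by (the
image of) `θ` — `F_v[θ] ⊆ L_w` is a finite-dimensional, hence closed, `F_v`-subspace containing the dense image
of `L`. [cite: NeukirchANT1999, Ch. II Prop. (8.3)] [cite: SerreLocalFields1979, II §3] -/
theorem adjoin_algebraMap_adicCompletion_eq_top {θ : L} (hθ : Algebra.adjoin F {θ} = ⊤) :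
    letI : Algebra (v.adicCompletion F) (w.adicCompletion L) := (adicCompletionMap (K := F) L v w).toAlgebra
    Algebra.adjoin (v.adicCompletion F) {algebraMap L (w.adicCompletion L) θ} = ⊤ := by
  letI : Algebra (v.adicCompletion F) (w.adicCompletion L) := (adicCompletionMap (K := F) L v w).toAlgebra
  obtain ⟨hfin, -⟩ := finrank_adicCompletion_le_of_liesOver L v w
  haveI : FiniteDimensional (v.adicCompletion F) (w.adicCompletion L) := hfin
  have hcoe : ∀ x : F, adicCompletionMap (K := F) L v w (algebraMap F (v.adicCompletion F) x) =
      algebraMap L (w.adicCompletion L) (algebraMap F L x) := fun x ↦ adicCompletionMap_coe (K := F) L v w x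
  haveI : IsScalarTower F (v.adicCompletion F) (w.adicCompletion L) :=
    IsScalarTower.of_algebraMap_eq fun x ↦ by
      rw [RingHom.algebraMap_toAlgebra, hcoe, ← IsScalarTower.algebraMap_apply]
  haveI : ContinuousSMul (v.adicCompletion F) (w.adicCompletion L) :=
    ⟨((continuous_adicCompletionMap (K := F) L v w).comp continuous_fst).mul continuous_snd⟩
  set B : Subalgebra (v.adicCompletion F) (w.adicCompletion L) :=
    Algebra.adjoin (v.adicCompletion F) {algebraMap L (w.adicCompletion L) θ} with hBdef
  -- the image of `L = F[θ]` lies in `B`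
  have hsub : Set.range (algebraMap L (w.adicCompletion L)) ⊆ B := by
    let A : Subalgebra F L :=
      { carrier := {l | algebraMap L (w.adicCompletion L) l ∈ B}
        mul_mem' := fun {a b} ha hb => by
          change algebraMap L _ (a * b) ∈ B
          rw [map_mul]; exact B.mul_mem ha hb
        one_mem' := by change algebraMap L _ 1 ∈ B; rw [map_one]; exact B.one_mem
        add_mem' := fun {a b} ha hb => by
          change algebraMap L _ (a + b) ∈ B
          rw [map_add]; exact B.add_mem ha hb
        zero_mem' := by change algebraMap L _ 0 ∈ B; rw [map_zero]; exact B.zero_mem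
        algebraMap_mem' := fun q => by
          change algebraMap L (w.adicCompletion L) (algebraMap F L q) ∈ B
          rw [← IsScalarTower.algebraMap_apply F L (w.adicCompletion L),
            IsScalarTower.algebraMap_apply F (v.adicCompletion F) (w.adicCompletion L)]
          exact B.algebraMap_mem _ }
    have hθA : θ ∈ A := by
      change algebraMap L (w.adicCompletion L) θ ∈ B
      exact Algebra.subset_adjoin (Set.mem_singleton _)
    have hA : A = ⊤ :=
      top_le_iff.mp (hθ.symm.le.trans (Algebra.adjoin_le (Set.singleton_subset_iff.mpr hθA)))
    rintro _ ⟨l, rfl⟩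
    have hl : l ∈ A := by rw [hA]; exact Algebra.mem_top
    exact hl
  -- `B` is closed (a finite-dimensional subspace) and the image of `L` is dense
  have hclosed : IsClosed (B : Set (w.adicCompletion L)) :=
    Submodule.closed_of_finiteDimensional (𝕜 := v.adicCompletion F) (E := w.adicCompletion L)
      (Subalgebra.toSubmodule B)
  have hdense : DenseRange (algebraMap L (w.adicCompletion L)) := w.denseRange_algebraMap L
  have hB : (B : Set (w.adicCompletion L)) = Set.univ := by
    refine Set.eq_univ_of_forall fun y ↦ ?_
    have hy : y ∈ closure (Set.range (algebraMap L (w.adicCompletion L))) := by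
      rw [hdense.closure_range]; exact Set.mem_univ y
    exact hclosed.closure_subset_iff.mpr hsub hy
  exact SetLike.coe_injective (by rw [hB, Algebra.coe_top])

/-- **The local inertia group `I_𝔐 ≤ Γ_{F_v}` fixes the Galois closure of `L_w/F_v`**, i.e. `I_𝔐 ≤ Γ_{\tilde L_w}`
(the tree's `finGalSubgroup`), for `L = F[θ]` with `θ² = c`, `c = 1 + 4d ∈ 𝓞 F`, at every finite place `v ∤ c`
(also `v ∣ 2`): `\tilde L_w` is generated by the `F_v`-conjugates `f(θ)` (`L_w = F_v[θ]`,
`adjoin_algebraMap_adicCompletion_eq_top`), square roots of `c`, which `I_𝔐` fixes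
(`smul_eq_of_mem_localInertia_of_sq_eq_one_add_four_mul`). This is "`v` is UNRAMIFIED in `F(√c)`" in the
Galois form consumed by §1. [cite: NeukirchANT1999, Ch. II Prop. (7.13), Prop. (9.6) and Ch. V Lemma (3.4)] -/
theorem localInertia_le_finGalSubgroup_of_sq_eq_one_add_four_mul {θ : L} (hθ : Algebra.adjoin F {θ} = ⊤)
    {c d : 𝓞 F} (hcd : c = 1 + 4 * d) (hc : θ ^ 2 = algebraMap (𝓞 F) L c) (hcv : c ∉ v.asIdeal)
    {𝔐 : Ideal (v.localAbsIntegers)} (h𝔐 : 𝔐 ∈ v.localPrimesAbove) :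
    letI : Algebra (v.adicCompletion F) (w.adicCompletion L) := (adicCompletionMap (K := F) L v w).toAlgebra
    𝔐.inertia (absoluteGaloisGroup (v.adicCompletion F)) ≤
      finGalSubgroup (E := v.adicCompletion F) (w.adicCompletion L) := by
  letI : Algebra (v.adicCompletion F) (w.adicCompletion L) := (adicCompletionMap (K := F) L v w).toAlgebra
  obtain ⟨hfin, -⟩ := finrank_adicCompletion_le_of_liesOver L v w
  haveI : FiniteDimensional (v.adicCompletion F) (w.adicCompletion L) := hfin
  have hcoe : ∀ x : F, adicCompletionMap (K := F) L v w (algebraMap F (v.adicCompletion F) x) =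
      algebraMap L (w.adicCompletion L) (algebraMap F L x) := fun x ↦ adicCompletionMap_coe (K := F) L v w x
  haveI : IsScalarTower F (v.adicCompletion F) (w.adicCompletion L) :=
    IsScalarTower.of_algebraMap_eq fun x ↦ by
      rw [RingHom.algebraMap_toAlgebra, hcoe, ← IsScalarTower.algebraMap_apply]
  have htop : Algebra.adjoin (v.adicCompletion F) {algebraMap L (w.adicCompletion L) θ} = ⊤ :=
    adjoin_algebraMap_adicCompletion_eq_top L v w hθ
  -- the `v`-unit `c ≡ 1 (mod 4)` in `𝓞_v`
  set cv : v.adicCompletionIntegers F := algebraMap (𝓞 F) (v.adicCompletionIntegers F) c with hcv_def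
  set dv : v.adicCompletionIntegers F := algebraMap (𝓞 F) (v.adicCompletionIntegers F) d with hdv_def
  have hcdv : cv = 1 + 4 * dv := by rw [hcv_def, hcd, map_add, map_one, map_mul, map_ofNat]
  have hcv' : cv ∉ IsLocalRing.maximalIdeal (v.adicCompletionIntegers F) := by
    rw [hcv_def, HeightOneSpectrum.algebraMap_mem_maximalIdeal_adicCompletionIntegers_iff]; exact hcv
  -- the relevant scalar towers
  have hOv : ∀ x : 𝓞 F, algebraMap (v.adicCompletionIntegers F) (v.adicCompletion F)
      (algebraMap (𝓞 F) (v.adicCompletionIntegers F) x) = algebraMap F (v.adicCompletion F) (algebraMap (𝓞 F) F x) :=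
    fun x ↦ rfl
  -- the image of `θ` in `L_w` squares to `c`
  have hθw : (algebraMap L (w.adicCompletion L) θ) ^ 2 =
      algebraMap (v.adicCompletion F) (w.adicCompletion L)
        (algebraMap (v.adicCompletionIntegers F) (v.adicCompletion F) cv) := by
    rw [← map_pow, hc, hcv_def, hOv, ← IsScalarTower.algebraMap_apply F (v.adicCompletion F),
      IsScalarTower.algebraMap_apply (𝓞 F) F L, ← IsScalarTower.algebraMap_apply F L]
  -- `I_𝔐 ≤ Γ_{\tilde L_w}`: every `F_v`-conjugate `f(L_w)` of `L_w` is fixed pointwise by `I_𝔐`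
  have key : finGaloisClosure (E := v.adicCompletion F) (w.adicCompletion L) ≤
      IntermediateField.fixedField
        (show Subgroup (AlgebraicClosure (v.adicCompletion F) ≃ₐ[v.adicCompletion F]
            AlgebraicClosure (v.adicCompletion F)) from 𝔐.inertia (absoluteGaloisGroup (v.adicCompletion F))) := by
    refine normalClosure_le_iff.mpr fun f ↦ ?_
    intro x hx
    obtain ⟨y, rfl⟩ := AlgHom.mem_fieldRange.mp hx
    rw [IntermediateField.mem_fixedField_iff]
    intro σ hσ
    change σ • f y = f y
    -- the elements of `L_w` whose image under `f` is fixed by `σ` form an `F_v`-subalgebra containing `θ`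
    let S : Subalgebra (v.adicCompletion F) (w.adicCompletion L) :=
      { carrier := {y | σ • f y = f y}
        mul_mem' := fun {a b} ha hb => by
          change σ • f (a * b) = f (a * b)
          rw [map_mul, smul_mul', ha, hb]
        one_mem' := by
          change σ • f 1 = f 1
          rw [map_one, smul_one]
        add_mem' := fun {a b} ha hb => by
          change σ • f (a + b) = f (a + b)
          rw [map_add, smul_add, ha, hb]
        zero_mem' := by
          change σ • f 0 = f 0
          rw [map_zero, smul_zero]
        algebraMap_mem' := fun q => by
          change σ • f (algebraMap (v.adicCompletion F) (w.adicCompletion L) q) =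
            f (algebraMap (v.adicCompletion F) (w.adicCompletion L) q)
          rw [AlgHom.commutes, AlgEquiv.smul_def]
          exact AlgEquiv.commutes _ q }
    have hα : (f (algebraMap L (w.adicCompletion L) θ)) ^ 2 =
        algebraMap (v.adicCompletionIntegers F) (AlgebraicClosure (v.adicCompletion F)) cv := by
      rw [← map_pow, hθw, AlgHom.commutes, IsScalarTower.algebraMap_apply (v.adicCompletionIntegers F)
        (v.adicCompletion F) (AlgebraicClosure (v.adicCompletion F))]
    have hθS : algebraMap L (w.adicCompletion L) θ ∈ S :=
      smul_eq_of_mem_localInertia_of_sq_eq_one_add_four_mul v h𝔐 hσ hcdv hcv' hα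
    have hS : S = ⊤ :=
      top_le_iff.mp (htop.symm.le.trans (Algebra.adjoin_le (Set.singleton_subset_iff.mpr hθS)))
    have hy : y ∈ S := by rw [hS]; exact Algebra.mem_top
    exact hy
  intro σ hσ
  refine (IntermediateField.mem_fixingSubgroup_iff _ _).mpr fun x hx ↦ ?_
  exact ((IntermediateField.mem_fixedField_iff _ _).mp (key hx)) σ hσ

end Quadratic


end Summit.BirchSwinnertonDyer.BirchSwinnertonDyer.Theorems.GenusExact.SelmerDescent

end
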